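import Literature.Analysis.Complex.PQExhaustionZero
import Literature.Analysis.Complex.OkaAnalyticPolyhedron
import Mathlib.Geometry.Manifold.PartitionOfUnity
import Mathlib.Analysis.SpecialFunctions.Complex.LogDeriv
import HarnessLib

/-!
# The Cousin problems on `ℂⁿ`: `H¹(𝔘, 𝒪) = 0` for every open cover, and Oka's principle for line bundles

Everything in this file is PROVED (no named facts).

**Cousin I** (`exists_holomorphic_cochain_of_cocycle`). Let `𝔘 = (U_k)_{k ∈ κ}` be ANY open cover
of `ℂ^ι` (`ι` finite) and `c_{kl} ∈ 𝒪(U_k ∩ U_l)` a holomorphic `1`-cocycle,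
`c_{kl} + c_{lm} = c_{km}` on `U_k ∩ U_l ∩ U_m`. Then there are `h_k ∈ 𝒪(U_k)` with
`c_{kl} = h_k - h_l` on `U_k ∩ U_l`; i.e. `H¹(𝔘, 𝒪) = 0`, so every Cousin-I distribution on `ℂⁿ`
is solvable (Fritzsche–Grauert, Ch. V §1, Prop. 1.6 and the Remark after it: what is used of the
base is only `H¹(X, 𝒪) = 0`). The proof is the one printed in Fritzsche–Grauert, Ch. VI §2
(proof of Dolbeault's theorem 2.9, injectivity of `D : H¹(X, 𝒪) → H^{0,1}(X)`): with a smooth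
partition of unity `(e_m)` subordinate to `𝔘` put `φ_k = ∑_m e_m c_{km}` (smooth on `U_k`,
`φ_k - φ_l = ∑_m e_m (c_{km} - c_{lm}) = c_{kl}`), glue the `∂̄φ_k` to a global `∂̄`-closed
`(0,1)`-form `ω`, solve `∂̄ρ = ω` on `ℂ^ι` — here by the tree's
`Literature.Analysis.Complex.exists_dbar_potential_on_univ_zero` (Hörmander, Thm. 2.7.8 for
`Ω = ℂⁿ`) — and take `h_k = φ_k - ρ`, holomorphic because `∂̄h_k = 0`
(`Literature.Analysis.Complex.differentiableOn_complex_of_typeZero`).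

**Cousin II with a continuous solution = Oka's principle for line bundles**
(`exists_holomorphic_trivialisation_of_continuous`). Let `g_{kl} ∈ 𝒪(U_k ∩ U_l)` and let
`μ_k : U_k → ℂˣ` be CONTINUOUS with `g_{kl} μ_l = μ_k` on `U_k ∩ U_l` (so `(g_{kl})` is a
holomorphic `𝒪ˣ`-cocycle which is a continuous coboundary: the holomorphic line bundle it defines
is topologically trivial). Then there are HOLOMORPHIC `ν_k : U_k → ℂˣ` with `g_{kl} ν_l = ν_k`
(the bundle is holomorphically trivial). This is the rank-one, base-`ℂⁿ` case of Grauert's Oka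
principle (Fritzsche–Grauert, Ch. V §1.5 (2); K. Oka 1939 for domains of holomorphy), proved
here through the exponential sequence as in Fritzsche–Grauert, Ch. V §1 ("Chern class and
exponential sequence", Prop. 1.7–1.8): on the refinement `W_{(k,x)} = {y ∈ U_k : |μ_k y - μ_k x| <
|μ_k x|}` the `μ_k` have continuous logarithms, their differences are continuous logarithms of
the holomorphic `g_{kl}`, hence holomorphic (`differentiableOn_of_continuousOn_of_exp`), and form
an additive cocycle; Cousin I writes it as a coboundary `h_a - h_b`, and `ν = exp h` descends from
the refinement because `exp (h_a - h_b) = μ_k / μ_k = 1` when `a`, `b` refine the same `U_k`.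

Auxiliary: the `0`-form `zeroForm f = f · 1 ∈ Λ⁰` of a function and its calculus
(`typeProjAt_zero_one_extDeriv_eq_zero`: `(dF)^{0,1} = 0` at points of complex
differentiability), continuous logarithms of holomorphic functions are holomorphic.

## References

* K. Fritzsche, H. Grauert, *From Holomorphic Functions to Complex Manifolds*, GTM 213 (2002),
  Ch. V §1 (Cousin-I and Cousin-II distributions, Prop. 1.6–1.8, Oka's principle 1.5),
  Ch. VI §2 (proof of Dolbeault's theorem 2.9). [FritzscheGrauert2002]
* L. Hörmander, *An Introduction to Complex Analysis in Several Variables*, 2nd ed. (1973),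
  Thm. 2.7.8. [HormanderSCV1973]
* K. Oka, *Sur les fonctions analytiques de plusieurs variables. III. Deuxième problème de
  Cousin*, J. Sci. Hiroshima Univ. Ser. A 9 (1939) 7–19, zbl:0020.24002,
  doi:10.32917/hmj/1558490525 (original of the rank-one Oka principle; not held, cited for
  context only).
-/

noncomputable section

open scoped ContDiff Topology Manifold Real
open Complex Function Set Filter Metric ContinuousAlternatingMap
open Literature.LinearAlgebra.Alternating Literature.NumberTheory.Transcendental

namespace Literature.Analysis.Complex

variable {ι : Type*} [Fintype ι] [DecidableEq ι]

/-! ### `0`-forms attached to functions -/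

section ZeroForm

omit [DecidableEq ι]

/-- The flat `0`-form `x ↦ f(x) · 1 ∈ Λ⁰(ℂ^ι) ≅ ℂ` attached to a function `f : ℂ^ι → ℂ`.
[folklore] -/
def zeroForm (f : (ι → ℂ) → ℂ) : (ι → ℂ) → (ι → ℂ) [⋀^Fin 0]→L[ℝ] ℂ :=
  fun x ↦ f x • ContinuousAlternatingMap.constOfIsEmpty ℝ (ι → ℂ) (Fin 0) (1 : ℂ)

omit [Fintype ι] in
/-- Values of the `0`-form of `f` (on the empty tuple): `f x`. [folklore] -/
@[simp]
theorem zeroForm_apply (f : (ι → ℂ) → ℂ) (x : ι → ℂ) (v : Fin 0 → ι → ℂ) :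
    zeroForm f x v = f x := by
  simp [zeroForm]

omit [Fintype ι] in
/-- `zeroForm` is additive in `f` (pointwise). [folklore] -/
theorem zeroForm_add_apply (f g : (ι → ℂ) → ℂ) (x : ι → ℂ) :
    zeroForm (fun y ↦ f y + g y) x = zeroForm f x + zeroForm g x := by
  ext v
  simp [zeroForm]

omit [Fintype ι] in
/-- `zeroForm` is subtractive in `f` (pointwise). [folklore] -/
theorem zeroForm_sub_apply (f g : (ι → ℂ) → ℂ) (x : ι → ℂ) :
    zeroForm (fun y ↦ f y - g y) x = zeroForm f x - zeroForm g x := by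
  ext v
  simp [zeroForm]

/-- Smoothness of the `0`-form of a smooth function, on a set. [folklore] -/
theorem contDiffOn_zeroForm {f : (ι → ℂ) → ℂ} {s : Set (ι → ℂ)} {n : WithTop ℕ∞}
    (hf : ContDiffOn ℝ n f s) : ContDiffOn ℝ n (zeroForm f) s :=
  hf.smul contDiffOn_const

/-- Smoothness of the `0`-form of a smooth function. [folklore] -/
theorem contDiff_zeroForm {f : (ι → ℂ) → ℂ} {n : WithTop ℕ∞} (hf : ContDiff ℝ n f) :
    ContDiff ℝ n (zeroForm f) :=
  hf.smul contDiff_const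

/-- Complex differentiability of the `0`-form of a complex-differentiable function. [folklore] -/
theorem differentiableAt_zeroForm {f : (ι → ℂ) → ℂ} {x : ι → ℂ} (hf : DifferentiableAt ℂ f x) :
    DifferentiableAt ℂ (zeroForm f) x :=
  hf.smul_const _

/-- Real differentiability of the `0`-form of a real-differentiable function. [folklore] -/
theorem differentiableAt_real_zeroForm {f : (ι → ℂ) → ℂ} {x : ι → ℂ}
    (hf : DifferentiableAt ℝ f x) : DifferentiableAt ℝ (zeroForm f) x :=
  hf.smul_const _

/-- **Evaluation of `0`-forms** `Λ⁰(ℂ^ι) → ℂ`, `η ↦ η()`, a complex-linear continuous map (the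
inverse of `c ↦ c · 1`). [folklore] -/
def evalZeroForm : ((ι → ℂ) [⋀^Fin 0]→L[ℝ] ℂ) →L[ℂ] ℂ where
  toFun η := η ![]
  map_add' _ _ := rfl
  map_smul' _ _ := rfl
  cont := continuous_eval_const _

omit [Fintype ι] in
/-- `evalZeroForm η = η()` (definitional). [folklore] -/
@[simp]
theorem evalZeroForm_apply (η : (ι → ℂ) [⋀^Fin 0]→L[ℝ] ℂ) : evalZeroForm η = η ![] :=
  rfl

omit [Fintype ι] in
/-- A `0`-form is determined by its value on the empty tuple. [folklore] -/
theorem zeroForm_evalZeroForm (F : (ι → ℂ) → (ι → ℂ) [⋀^Fin 0]→L[ℝ] ℂ) :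
    zeroForm (fun x ↦ evalZeroForm (F x)) = F := by
  funext x
  ext v
  rw [zeroForm_apply, evalZeroForm_apply]
  congr 1
  exact Subsingleton.elim _ _

end ZeroForm

/-! ### `∂̄` of `0`-forms -/

section DbarZero

omit [Fintype ι] [DecidableEq ι] in
/-- Every `0`-form has pointwise type `(0,0)` (local copy of the lemma of
`Literature/Analysis/Complex/PolyhedronApprox.lean`, which is not imported here). [folklore] -/
private theorem isOfTypeAt_fin_zero {E : Type*} [NormedAddCommGroup E] [NormedSpace ℂ E]
    (η : E [⋀^Fin 0]→L[ℝ] ℂ) : IsOfTypeAt 0 0 η :=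
  ⟨rfl, fun θ v ↦ by
    have h : (fun i ↦ exp (θ * I) • v i) = v := Subsingleton.elim _ _
    rw [h]
    simp⟩

/-- **`(dF)^{0,1}(x) = 0` for a `0`-form complex-differentiable at `x`** (its differential is
`ℂ`-linear, of type `(1,0)`; in coordinates all `∂F/∂z̄_j (x)` vanish).
[cite: HormanderSCV1973, §2.1] -/
theorem typeProjAt_zero_one_extDeriv_eq_zero {G : (ι → ℂ) → (ι → ℂ) [⋀^Fin 0]→L[ℝ] ℂ}
    {x : ι → ℂ} (hG : DifferentiableAt ℂ G x) : typeProjAt 0 (0 + 1) (extDeriv G x) = 0 := by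
  rw [typeProjAt_extDeriv_eq_sum fun y ↦ isOfTypeAt_fin_zero (G y)]
  exact Finset.sum_eq_zero fun j _ ↦ by
    rw [dbarAlong_eq_zero_of_differentiableAt hG, wedgeOne_zero]

omit [DecidableEq ι] in
/-- The exterior derivative of a sum of differentiable flat forms. [folklore] -/
theorem extDeriv_add_apply {k : ℕ} {ω₁ ω₂ : (ι → ℂ) → (ι → ℂ) [⋀^Fin k]→L[ℝ] ℂ} {x : ι → ℂ}
    (h₁ : DifferentiableAt ℝ ω₁ x) (h₂ : DifferentiableAt ℝ ω₂ x) :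
    extDeriv (fun y ↦ ω₁ y + ω₂ y) x = extDeriv ω₁ x + extDeriv ω₂ x := by
  simp only [extDeriv, ← alternatizeUncurryFinCLM_apply]
  rw [fderiv_fun_add h₁ h₂, map_add]

/-- **`∂̄`-closed `0`-forms are holomorphic functions**: if `F : ℂ^ι → Λ⁰` is real-differentiable
on an open `U` with `(dF)^{0,1} = 0` on `U`, then `x ↦ F(x)()` is complex-differentiable on `U`.
[cite: HormanderSCV1973, §2.1] -/
theorem differentiableOn_evalZeroForm_of_dbar_eq_zero {F : (ι → ℂ) → (ι → ℂ) [⋀^Fin 0]→L[ℝ] ℂ}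
    {U : Set (ι → ℂ)} (hU : IsOpen U) (hd : DifferentiableOn ℝ F U)
    (hc : ∀ x ∈ U, typeProjAt 0 (0 + 1) (extDeriv F x) = 0) :
    DifferentiableOn ℂ (fun x ↦ evalZeroForm (F x)) U :=
  evalZeroForm.differentiable.comp_differentiableOn
    (differentiableOn_complex_of_typeZero (p := 0) hU hd (fun y ↦ isOfTypeAt_fin_zero (F y)) hc)

end DbarZero

/-! ### Cousin I on `ℂ^ι` -/

section CousinI

variable {κ : Type*}

omit [DecidableEq ι] in
/-- **The smooth solution of the additive Cousin problem** (Fritzsche–Grauert, proof of VI.2.9: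
`φ_k = ∑_m e_m c_{km}` for a smooth partition of unity `(e_m)` subordinate to the cover): for an
open cover `(U_k)` of `ℂ^ι` and holomorphic `c_{kl}` on `U_k ∩ U_l` with
`c_{kl} + c_{lm} = c_{km}` on triple overlaps there are `φ_k`, real-`C^∞` on `U_k`, with
`φ_k - φ_l = c_{kl}` on `U_k ∩ U_l`. [cite: FritzscheGrauert2002, Ch. VI §2 (proof of Thm. 2.9)] -/
theorem exists_smooth_cochain_of_cocycle (U : κ → Set (ι → ℂ)) (hU : ∀ k, IsOpen (U k))
    (hcov : ∀ x, ∃ k, x ∈ U k) (c : κ → κ → (ι → ℂ) → ℂ)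
    (hc : ∀ k l, DifferentiableOn ℂ (c k l) (U k ∩ U l))
    (hcyc : ∀ k l m, ∀ x ∈ U k ∩ U l ∩ U m, c k l x + c l m x = c k m x) :
    ∃ φ : κ → (ι → ℂ) → ℂ, (∀ k, ContDiffOn ℝ ∞ (φ k) (U k)) ∧
      ∀ k l, ∀ x ∈ U k ∩ U l, φ k x - φ l x = c k l x := by
  have hsub : ∀ k l m, ∀ x ∈ U k ∩ U l ∩ U m, c k m x - c l m x = c k l x :=
    fun k l m x hx ↦ by linear_combination (-1 : ℂ) * hcyc k l m x hx
  -- a smooth partition of unity subordinate to the cover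
  obtain ⟨ρ, hρ⟩ := SmoothPartitionOfUnity.exists_isSubordinate 𝓘(ℝ, ι → ℂ) isClosed_univ U hU
    fun x _ ↦ mem_iUnion.2 (hcov x)
  have hfin : ∀ x, (fun m ↦ ρ m x).HasFiniteSupport := fun x ↦
    (ρ.locallyFinite.point_finite x).subset fun _ hm ↦ hm
  refine ⟨fun k x ↦ ∑ᶠ m, ρ m x • c k m x, fun k x hx ↦ ?_, fun k l x hx ↦ ?_⟩
  · -- smoothness on `U_k`: near `x` only finitely many terms, each smooth where `ρ_m ≠ 0`
    refine ContDiffAt.contDiffWithinAt ?_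
    refine ρ.contDiffAt_finsum (n := ⊤) (g := fun m ↦ c k m) fun m hm ↦ ?_
    have ho : IsOpen (U k ∩ U m) := (hU k).inter (hU m)
    exact ((SCV.contDiffOn_infty (hc k m) ho).restrict_scalars ℝ).contDiffAt
      (ho.mem_nhds ⟨hx, hρ m hm⟩)
  · -- `φ_k - φ_l = ∑_m ρ_m (c_{km} - c_{lm}) = ∑_m ρ_m c_{kl} = c_{kl}`
    show ∑ᶠ m, ρ m x • c k m x - ∑ᶠ m, ρ m x • c l m x = c k l x
    have hfk : (fun m ↦ ρ m x • c k m x).HasFiniteSupport := (hfin x).smul_left fun m ↦ c k m x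
    have hfl : (fun m ↦ ρ m x • c l m x).HasFiniteSupport := (hfin x).smul_left fun m ↦ c l m x
    rw [← finsum_sub_distrib hfk hfl]
    have h1 : ∀ m, ρ m x • c k m x - ρ m x • c l m x = ρ m x • c k l x := fun m ↦ by
      by_cases hm : ρ m x = 0
      · simp [hm]
      · have hxm : x ∈ U m := hρ m (subset_tsupport _ hm)
        rw [← smul_sub, hsub k l m x ⟨hx, hxm⟩]
    rw [finsum_congr h1, ← finsum_smul, ρ.sum_eq_one (mem_univ x), one_smul]

/-- **The `∂̄`-correction** (Fritzsche–Grauert, proof of VI.2.9, injectivity of `D`): if the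
holomorphic cocycle `(c_{kl})` on the open cover `(U_k)` of `ℂ^ι` is the coboundary of a cochain
`(φ_k)` of functions real-`C^∞` on `U_k`, then it is the coboundary of a HOLOMORPHIC cochain: the
`∂̄φ_k` glue to a global `∂̄`-closed `(0,1)`-form `ω`, `∂̄ρ = ω` is solvable on `ℂ^ι`
(Hörmander 2.7.8), and `h_k = φ_k - ρ` is holomorphic with `h_k - h_l = c_{kl}`.
[cite: FritzscheGrauert2002, Ch. VI §2 (proof of Thm. 2.9)] -/
theorem exists_holomorphic_cochain_of_smooth (U : κ → Set (ι → ℂ)) (hU : ∀ k, IsOpen (U k))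
    (hcov : ∀ x, ∃ k, x ∈ U k) (c : κ → κ → (ι → ℂ) → ℂ)
    (hc : ∀ k l, DifferentiableOn ℂ (c k l) (U k ∩ U l)) (φ : κ → (ι → ℂ) → ℂ)
    (hφ : ∀ k, ContDiffOn ℝ ∞ (φ k) (U k))
    (hφc : ∀ k l, ∀ x ∈ U k ∩ U l, φ k x - φ l x = c k l x) :
    ∃ h : κ → (ι → ℂ) → ℂ, (∀ k, DifferentiableOn ℂ (h k) (U k)) ∧
      ∀ k l, ∀ x ∈ U k ∩ U l, h k x - h l x = c k l x := by
  -- the `0`-forms `F_k` and a pointwise choice of chart index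
  set F : κ → (ι → ℂ) → (ι → ℂ) [⋀^Fin 0]→L[ℝ] ℂ := fun k ↦ zeroForm (φ k) with hF
  have hFs : ∀ k, ContDiffOn ℝ ∞ (F k) (U k) := fun k ↦ contDiffOn_zeroForm (hφ k)
  have hFd : ∀ k, ∀ x ∈ U k, DifferentiableAt ℝ (F k) x := fun k x hx ↦
    ((hFs k).differentiableOn (by simp)).differentiableAt ((hU k).mem_nhds hx)
  set kx : (ι → ℂ) → κ := fun x ↦ Classical.choose (hcov x) with hkx
  have hkx_mem : ∀ x, x ∈ U (kx x) := fun x ↦ Classical.choose_spec (hcov x)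
  -- the global `(0,1)`-form `θ = ∂̄φ_k` on `U_k`
  set θ : (ι → ℂ) → (ι → ℂ) [⋀^Fin (0 + 1)]→L[ℝ] ℂ :=
    fun x ↦ typeProjAt 0 (0 + 1) (extDeriv (F (kx x)) x) with hθ
  -- `θ = ∂̄φ_k` on EVERY `U_k ∋ x` (the `φ_k` differ by holomorphic functions)
  have hloc : ∀ k x, x ∈ U k → θ x = typeProjAt 0 (0 + 1) (extDeriv (F k) x) := by
    intro k x hx
    have hx' : x ∈ U (kx x) := hkx_mem x
    have hev : F (kx x) =ᶠ[𝓝 x] fun y ↦ F k y + zeroForm (c (kx x) k) y := by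
      filter_upwards [((hU (kx x)).inter (hU k)).mem_nhds ⟨hx', hx⟩] with y hy
      simp only [hF]
      rw [← zeroForm_add_apply]
      simp only [zeroForm]
      congr 1
      linear_combination hφc (kx x) k y hy
    have hdc : DifferentiableAt ℂ (zeroForm (c (kx x) k)) x :=
      differentiableAt_zeroForm
        ((hc (kx x) k).differentiableAt (((hU (kx x)).inter (hU k)).mem_nhds ⟨hx', hx⟩))
    simp only [hθ]
    rw [extDeriv_congr_of_eventuallyEq hev, extDeriv_add_apply (hFd k x hx)
      (hdc.restrictScalars ℝ), typeProjAt_add, typeProjAt_zero_one_extDeriv_eq_zero hdc, add_zero]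
  -- near each point `θ = (dG)^{0,1}` for a GLOBALLY smooth `0`-form `G` (cut-off of `F_k`)
  have hθG : ∀ x₀, ∃ G : (ι → ℂ) → (ι → ℂ) [⋀^Fin 0]→L[ℝ] ℂ, ContDiff ℝ ∞ G ∧
      θ =ᶠ[𝓝 x₀] fun x ↦ typeProjAt 0 (0 + 1) (extDeriv G x) := by
    intro x₀
    set k := kx x₀ with hk
    obtain ⟨χ, hχs, -, hχU, O, hOo, hxO, hO1⟩ := exists_complex_cutoff_nhdsSet
      (isCompact_singleton : IsCompact ({x₀} : Set (ι → ℂ))) (hU k)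
      (singleton_subset_iff.2 (hkx_mem x₀))
    have hx₀O : x₀ ∈ O := hxO (mem_singleton x₀)
    refine ⟨fun x ↦ χ x • F k x, contDiff_smul_of_tsupport_subset (hU k) hχs hχU (hFs k), ?_⟩
    filter_upwards [hOo.mem_nhds hx₀O, (hU k).mem_nhds (hkx_mem x₀)] with x hxO' hxU
    have hev : F k =ᶠ[𝓝 x] fun y ↦ χ y • F k y := by
      filter_upwards [hOo.mem_nhds hxO'] with y hy
      rw [hO1 y hy, one_smul]
    rw [hloc k x hxU, extDeriv_congr_of_eventuallyEq hev]
  have hθs : ContDiff ℝ ∞ θ := contDiff_iff_contDiffAt.2 fun x₀ ↦ by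
    obtain ⟨G, hG, hθG'⟩ := hθG x₀
    exact (contDiff_typeProjAt_extDeriv 0 (0 + 1) hG).contDiffAt.congr_of_eventuallyEq hθG'
  have hθt : ∀ x, IsOfTypeAt 0 1 (θ x) := fun x ↦ isOfTypeAt_typeProjAt rfl _
  have hθc : ∀ x, typeProjAt 0 2 (extDeriv θ x) = 0 := fun x₀ ↦ by
    obtain ⟨G, hG, hθG'⟩ := hθG x₀
    rw [extDeriv_congr_of_eventuallyEq hθG']
    exact dbar_dbar_eq_zero (p := 0) (q := 0) (fun y ↦ isOfTypeAt_fin_zero (G y)) hG x₀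
  -- solve `∂̄β = θ` on all of `ℂ^ι`
  obtain ⟨β, hβs, -, hβθ⟩ := exists_dbar_potential_on_univ_zero (n := 0) (p := 0) hθs hθt hθc
  have hβθ' : ∀ x, typeProjAt 0 (0 + 1) (extDeriv β x) = θ x := hβθ
  have hβd : ∀ x, DifferentiableAt ℝ β x := fun x ↦
    (hβs.differentiable (by simp)).differentiableAt
  -- `h_k = φ_k - β()` is holomorphic on `U_k`
  refine ⟨fun k x ↦ φ k x - evalZeroForm (β x), fun k ↦ ?_, fun k l x hx ↦ by
    rw [← hφc k l x hx]; ring⟩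
  have hδ : DifferentiableOn ℂ (fun x ↦ evalZeroForm (F k x - β x)) (U k) := by
    refine differentiableOn_evalZeroForm_of_dbar_eq_zero (F := fun x ↦ F k x - β x) (hU k)
      (fun x hx ↦ ((hFd k x hx).sub (hβd x)).differentiableWithinAt) fun x hx ↦ ?_
    rw [extDeriv_sub_apply (hFd k x hx) (hβd x), typeProjAt_sub, ← hloc k x hx, hβθ' x, sub_self]
  refine hδ.congr fun x _ ↦ ?_
  simp [hF]

/-- **Cousin I on `ℂⁿ`: `H¹(𝔘, 𝒪) = 0` for every open cover `𝔘` of `ℂ^ι`.** For an open cover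
`(U_k)_{k ∈ κ}` of `ℂ^ι` and holomorphic `c_{kl}` on `U_k ∩ U_l` with `c_{kl} + c_{lm} = c_{km}`
on `U_k ∩ U_l ∩ U_m` there are holomorphic `h_k` on `U_k` with `c_{kl} = h_k - h_l` on
`U_k ∩ U_l`; hence every Cousin-I distribution on `ℂⁿ` has a solution (Fritzsche–Grauert
V.1.6 with the Remark following it: only `H¹(X, 𝒪) = 0` is used, supplied on `ℂⁿ` by
`H^{0,1}_{∂̄}(ℂⁿ) = 0`, Hörmander 2.7.8, and the partition-of-unity argument of the proof of
Dolbeault's theorem VI.2.9). [cite: FritzscheGrauert2002, Ch. V §1 Prop. 1.6 and Ch. VI §2 Thm. 2.9] -/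
theorem exists_holomorphic_cochain_of_cocycle (U : κ → Set (ι → ℂ)) (hU : ∀ k, IsOpen (U k))
    (hcov : ∀ x, ∃ k, x ∈ U k) (c : κ → κ → (ι → ℂ) → ℂ)
    (hc : ∀ k l, DifferentiableOn ℂ (c k l) (U k ∩ U l))
    (hcyc : ∀ k l m, ∀ x ∈ U k ∩ U l ∩ U m, c k l x + c l m x = c k m x) :
    ∃ h : κ → (ι → ℂ) → ℂ, (∀ k, DifferentiableOn ℂ (h k) (U k)) ∧
      ∀ k l, ∀ x ∈ U k ∩ U l, c k l x = h k x - h l x := by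
  obtain ⟨φ, hφ, hφc⟩ := exists_smooth_cochain_of_cocycle U hU hcov c hc hcyc
  obtain ⟨h, hh, hhc⟩ := exists_holomorphic_cochain_of_smooth U hU hcov c hc φ hφ hφc
  exact ⟨h, hh, fun k l x hx ↦ (hhc k l x hx).symm⟩

end CousinI

/-! ### Continuous logarithms of holomorphic functions -/

section Log

/-- **A continuous logarithm of a holomorphic function is holomorphic**: if `n` is continuous on
an open set `s` and `exp ∘ n` is complex-differentiable on `s`, then so is `n` (near `x₀`,
`n = log (exp (n - n x₀)) + n x₀` with the principal branch). [folklore] -/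
theorem differentiableOn_of_continuousOn_of_exp {E : Type*} [NormedAddCommGroup E]
    [NormedSpace ℂ E] {n : E → ℂ} {s : Set E} (hs : IsOpen s) (hn : ContinuousOn n s)
    (he : DifferentiableOn ℂ (fun y ↦ exp (n y)) s) : DifferentiableOn ℂ n s := by
  intro x₀ hx₀
  refine DifferentiableAt.differentiableWithinAt ?_
  have hcont : ContinuousAt n x₀ := hn.continuousAt (hs.mem_nhds hx₀)
  have hnear : ∀ᶠ y in 𝓝 x₀, ‖n y - n x₀‖ < π := by
    have h := Metric.tendsto_nhds.1 hcont π Real.pi_pos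
    simpa only [dist_eq_norm] using h
  have heq : n =ᶠ[𝓝 x₀] fun y ↦ log (exp (n y) * exp (-n x₀)) + n x₀ := by
    filter_upwards [hnear] with y hy
    have him : |(n y - n x₀).im| < π := (abs_im_le_norm _).trans_lt hy
    rw [← Complex.exp_add, ← sub_eq_add_neg, Complex.log_exp (abs_lt.1 him).1 (abs_lt.1 him).2.le,
      sub_add_cancel]
  refine DifferentiableAt.congr_of_eventuallyEq ?_ heq
  have hexp : DifferentiableAt ℂ (fun y ↦ exp (n y)) x₀ := he.differentiableAt (hs.mem_nhds hx₀)
  refine ((hexp.mul_const _).clog ?_).add_const _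
  simp only [← Complex.exp_add, add_neg_cancel, Complex.exp_zero]
  exact Complex.one_mem_slitPlane

end Log

/-! ### Cousin II with a continuous solution (Oka's principle in rank one) -/

section CousinII

variable {κ : Type*}

/-- **Oka's principle for line bundles on `ℂⁿ`** (the multiplicative Cousin problem with a
continuous solution has a holomorphic one): for an open cover `(U_k)` of `ℂ^ι`, holomorphic
`g_{kl}` on `U_k ∩ U_l` and CONTINUOUS nowhere-vanishing `μ_k` on `U_k` with `g_{kl} μ_l = μ_k` on
`U_k ∩ U_l`, there are HOLOMORPHIC nowhere-vanishing `ν_k` on `U_k` with `g_{kl} ν_l = ν_k` on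
`U_k ∩ U_l`. Equivalently: a holomorphic line bundle on `ℂⁿ` (cocycle `g_{kl} = μ_k μ_l⁻¹`) that
is topologically trivial is holomorphically trivial — Fritzsche–Grauert V.1.5 (2) for `r = 1`,
`X = ℂⁿ`; proof by the exponential sequence (FG V §1, Prop. 1.7–1.8): continuous logarithms on
the refinement `W_{(k,x)} = {y ∈ U_k : |μ_k y - μ_k x| < |μ_k x|}`, their differences are
holomorphic (`differentiableOn_of_continuousOn_of_exp`) and form an additive cocycle, which is a
holomorphic coboundary by Cousin I (`exists_holomorphic_cochain_of_cocycle`); exponentiate and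
descend. [cite: FritzscheGrauert2002, Ch. V §1.5 (Oka's principle) (2) and §1 Prop. 1.7–1.8] -/
theorem exists_holomorphic_trivialisation_of_continuous (U : κ → Set (ι → ℂ))
    (hU : ∀ k, IsOpen (U k)) (hcov : ∀ x, ∃ k, x ∈ U k) (g : κ → κ → (ι → ℂ) → ℂ)
    (hg : ∀ k l, DifferentiableOn ℂ (g k l) (U k ∩ U l)) (μ : κ → (ι → ℂ) → ℂ)
    (hμ : ∀ k, ContinuousOn (μ k) (U k)) (hμ0 : ∀ k, ∀ x ∈ U k, μ k x ≠ 0)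
    (hgμ : ∀ k l, ∀ x ∈ U k ∩ U l, g k l x * μ l x = μ k x) :
    ∃ ν : κ → (ι → ℂ) → ℂ, (∀ k, DifferentiableOn ℂ (ν k) (U k)) ∧ (∀ k, ∀ x ∈ U k, ν k x ≠ 0) ∧
      ∀ k l, ∀ x ∈ U k ∩ U l, g k l x * ν l x = ν k x := by
  -- the refinement `W_{(k,x)} = {y ∈ U_k : |μ_k y - μ_k x| < |μ_k x|}`, indexed by `κ × ℂ^ι`
  set W : κ × (ι → ℂ) → Set (ι → ℂ) :=
    fun a ↦ U a.1 ∩ μ a.1 ⁻¹' ball (μ a.1 a.2) ‖μ a.1 a.2‖ with hW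
  have hWo : ∀ a, IsOpen (W a) := fun a ↦ (hμ a.1).isOpen_inter_preimage (hU a.1) isOpen_ball
  have hmemW : ∀ k y, y ∈ U k → y ∈ W (k, y) := fun k y hy ↦
    ⟨hy, mem_ball_self (norm_pos_iff.2 (hμ0 k y hy))⟩
  have hWcov : ∀ y, ∃ a, y ∈ W a := fun y ↦
    let ⟨k, hk⟩ := hcov y
    ⟨(k, y), hmemW k y hk⟩
  have hμx : ∀ a, ∀ y ∈ W a, ‖μ a.1 y - μ a.1 a.2‖ < ‖μ a.1 a.2‖ ∧ μ a.1 a.2 ≠ 0 := by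
    intro a y hy
    have h := hy.2
    rw [mem_preimage, mem_ball, dist_eq_norm] at h
    exact ⟨h, norm_pos_iff.1 ((norm_nonneg _).trans_lt h)⟩
  -- continuous logarithms `m_a` of `μ_{a.1}` on `W_a`
  set m : κ × (ι → ℂ) → (ι → ℂ) → ℂ :=
    fun a y ↦ log (μ a.1 y / μ a.1 a.2) + log (μ a.1 a.2) with hm
  have hquot : ∀ a, ∀ y ∈ W a, μ a.1 y / μ a.1 a.2 ∈ slitPlane := by
    intro a y hy
    obtain ⟨hlt, h0⟩ := hμx a y hy
    have h1 : ‖μ a.1 y / μ a.1 a.2 - 1‖ < 1 := by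
      rw [div_sub_one h0, norm_div, div_lt_one (norm_pos_iff.2 h0)]
      exact hlt
    rw [Complex.mem_slitPlane_iff]
    left
    have h2 := (abs_re_le_norm (μ a.1 y / μ a.1 a.2 - 1)).trans_lt h1
    rw [sub_re, one_re] at h2
    linarith [(abs_lt.1 h2).1]
  have hm_cont : ∀ a, ContinuousOn (m a) (W a) := fun a ↦
    ((((hμ a.1).mono inter_subset_left).div_const _).clog (hquot a)).add continuousOn_const
  have hm_exp : ∀ a, ∀ y ∈ W a, exp (m a y) = μ a.1 y := by
    intro a y hy
    have h0x : μ a.1 a.2 ≠ 0 := (hμx a y hy).2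
    have h0y : μ a.1 y ≠ 0 := hμ0 a.1 y hy.1
    simp only [hm]
    rw [Complex.exp_add, Complex.exp_log (div_ne_zero h0y h0x), Complex.exp_log h0x,
      div_mul_cancel₀ _ h0x]
  -- the additive cocycle `n_{ab} = m_a - m_b` is holomorphic (a continuous logarithm of `g`)
  set n : κ × (ι → ℂ) → κ × (ι → ℂ) → (ι → ℂ) → ℂ := fun a b y ↦ m a y - m b y with hn
  have hexp_n : ∀ a b, ∀ y ∈ W a ∩ W b, exp (n a b y) * μ b.1 y = μ a.1 y := by
    intro a b y hy
    simp only [hn]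
    rw [Complex.exp_sub, hm_exp a y hy.1, hm_exp b y hy.2, div_mul_cancel₀ _ (hμ0 b.1 y hy.2.1)]
  have hn_hol : ∀ a b, DifferentiableOn ℂ (n a b) (W a ∩ W b) := by
    intro a b
    refine differentiableOn_of_continuousOn_of_exp ((hWo a).inter (hWo b))
      (((hm_cont a).mono inter_subset_left).sub ((hm_cont b).mono inter_subset_right)) ?_
    refine ((hg a.1 b.1).mono fun y hy ↦ ⟨hy.1.1, hy.2.1⟩).congr fun y hy ↦ ?_
    exact mul_right_cancel₀ (hμ0 b.1 y hy.2.1)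
      ((hexp_n a b y hy).trans (hgμ a.1 b.1 y ⟨hy.1.1, hy.2.1⟩).symm)
  have hn_cyc : ∀ a b d, ∀ y ∈ W a ∩ W b ∩ W d, n a b y + n b d y = n a d y :=
    fun a b d y _ ↦ by simp only [hn]; ring
  -- Cousin I on the refinement
  obtain ⟨h, hh, hhn⟩ := exists_holomorphic_cochain_of_cocycle W hWo hWcov n hn_hol hn_cyc
  have hexp_h : ∀ a b, ∀ y ∈ W a ∩ W b, exp (h a y) = exp (n a b y) * exp (h b y) := by
    intro a b y hy
    rw [← Complex.exp_add, hhn a b y hy, sub_add_cancel]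
  -- descend: `ν_k (y) = exp (h_{(k,y)} (y))`, locally `= exp ∘ h_{(k,y₀)}`
  refine ⟨fun k y ↦ exp (h (k, y) y), fun k y₀ hy₀ ↦ ?_, fun k y _ ↦ Complex.exp_ne_zero _,
    fun k l y hy ↦ ?_⟩
  · have hev : (fun y ↦ exp (h (k, y) y)) =ᶠ[𝓝 y₀] fun y ↦ exp (h (k, y₀) y) := by
      filter_upwards [(hWo (k, y₀)).mem_nhds (hmemW k y₀ hy₀)] with y hy
      have hyy : y ∈ W (k, y) := hmemW k y hy.1
      have h1 := hexp_n (k, y) (k, y₀) y ⟨hyy, hy⟩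
      rw [mul_eq_right₀ (hμ0 k y hy.1)] at h1
      rw [hexp_h (k, y) (k, y₀) y ⟨hyy, hy⟩, h1, one_mul]
    refine (DifferentiableAt.congr_of_eventuallyEq ?_ hev).differentiableWithinAt
    exact ((hh (k, y₀)).differentiableAt ((hWo _).mem_nhds (hmemW k y₀ hy₀))).cexp
  · have hyk : y ∈ W (k, y) := hmemW k y hy.1
    have hyl : y ∈ W (l, y) := hmemW l y hy.2
    show g k l y * exp (h (l, y) y) = exp (h (k, y) y)
    rw [hexp_h (k, y) (l, y) y ⟨hyk, hyl⟩]
    congr 1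
    exact mul_right_cancel₀ (hμ0 l y hy.2)
      ((hgμ k l y hy).trans (hexp_n (k, y) (l, y) y ⟨hyk, hyl⟩).symm)

end CousinII

end Literature.Analysis.Complex

end
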